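import Summits.QuantumFields.QCD.Theorems.PauliWegnerSeaChiralOneScaleTrajectoryJensenGeneral
import Summits.QuantumFields.QCD.Theorems.PauliWegnerSeaChiralOneScaleTrajectorySchemeVolumePin
import Summits.QuantumFields.QCD.Theses.PauliWegnerSea

/-!
# Signed pin from unsigned lower pins and sign coherence at the scheme volume (line `Sketch`, crux
`PauliWegnerSea.ChiralOneScaleTrajectory`, stmt-QuantumFields-17512; the `N_f = 3` kernel Sign₃ typed)

`signedPin_of_lowerPins_signCoh`: for `N_f ≥ 2`, a regularisation with `a_k ≤ 1` eventually and superlogarithmic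
physical volume, NoCollapse lower pins for the crux's OWN `|det|`-weighted fractional moment at degenerate tuples
(`∀ ε ∃ m s c₀ C₁ p`, `C₁ < sε/2`, clause-(iii)-shaped, all `S ≥ L_k`, `n ≤ S`), and SIGN COHERENCE OF THE PION
INTEGRAND AT THE SCHEME VOLUME — `θ · E₊[Σ|G_f|²](k, L_k, L_k) ≤ ‖(∫ det D Σ|G_f|² dμ_W)/(∫ det D dμ_W)‖` eventually in
`k`, for every `m > 0` — satisfies the signed second-moment pin (hypothesis of `chiralityTransfer_ae`): the lower pin is
moved to `S = n = L_k` (`eventually_violation_at_schemeVolume_of_eventual_lowerPin`), Jensen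
(`fm_rpow_le_secondMoment_const`) turns it into an unsigned second-moment violation there, and sign coherence makes it a
signed one.  For `N_f = 2` the coherence holds with `θ = 1` (`det D = |det D|`); for `N_f = 3` it is the card's kernel
Sign₃, asked only at the volume where clause (iv) of the crux grants `‖∫det D‖ ≥ ½ ∫|det D|`.  Folklore bookkeeping.
-/

noncomputable section

namespace Summit.QuantumFields.QCD.Cruxes.ChiralOneScaleTrajectory.GoldstoneWitness

open scoped BigOperators
open MeasureTheory Filter
open Literature.MathematicalPhysics.QuantumFieldTheory Literature.MathematicalPhysics.QuantumLattice
  Literature.Probability.LatticeModels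

/-- **NoCollapse lower pins ∧ sign coherence at the scheme volume ⇒ signed second-moment pin** (`N_f ≥ 2`). -/
theorem signedPin_of_lowerPins_signCoh :
    ∀ (Nf : ℕ), 2 ≤ Nf → ∀ (reg : QCDRegularisation Nf) (f : Fin Nf), (∀ᶠ k in atTop, reg.a k ≤ 1) → Tendsto (fun k => reg.a k * reg.L k / (1 + |Real.log (reg.a k)|)) atTop atTop → (∀ ε : ℝ, 0 < ε → ∃ m s c₀ C₁ p : ℝ, 0 < m ∧ 0 < s ∧ s ≤ 2 ∧ 0 < c₀ ∧ C₁ < s * ε / 2 ∧ ∀ᶠ k in atTop, ∀ S : ℕ, reg.L k ≤ S → ∀ n : ℕ, n ≤ S → c₀ * Real.exp (-(C₁ * (reg.a k * n) + p * Real.log (n + 1))) ≤ (∫ U : GaugeConfig 4 (2 * S + 1) (Matrix.specialUnitaryGroup (Fin 3) ℂ), ‖(diracMatrix U fun _ : Fin Nf => reg.mcrit k + reg.a k * m / reg.Zm k).det‖ * (∑ a : Fin 3, ∑ i : Fin 4, ∑ b : Fin 3, ∑ j : Fin 4, ‖(diracMatrix U fun _ : Fin Nf => reg.mcrit k + reg.a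 k * m / reg.Zm k)⁻¹ (quarkEquiv (f, (Torus.proj (2 * S + 1) 0, a, i))) (quarkEquiv (f, (Torus.proj (2 * S + 1) (Pi.single 0 (n : ℤ)), b, j)))‖) ^ s ∂(wilsonMeasure (fundamentalRep (Fin 3)) (reg.β k))) / (∫ U : GaugeConfig 4 (2 * S + 1) (Matrix.specialUnitaryGroup (Fin 3) ℂ), ‖(diracMatrix U fun _ : Fin Nf => reg.mcrit k + reg.a k * m / reg.Zm k).det‖ ∂(wilsonMeasure (fundamentalRep (Fin 3)) (reg.β k)))) → (∃ θ : ℝ, 0 < θ ∧ ∀ m : ℝ, 0 < m → ∀ᶠ k in atTop, θ * ((∫ U : GaugeConfig 4 (2 * reg.L k + 1) (Matrix.specialUnitaryGroup (Fin 3) ℂ), ‖(diracMatrix U fun _ : Fin Nf => reg.mcrit k + reg.a k * m / reg.Zm k).det‖ * (∑ a : Fin 3, ∑ i : Fin 4, ∑ b : Fin 3, ∑ j : Fin 4, ‖(diracMatrix U fun _ : Fin Nf => reg.mcrit k + reg.a k * m / reg.Zm k)⁻¹ (quarkEquiv (f, (Torus.proj (2 * reg.L k + 1) 0, a, i))) (quarkEquiv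 (f, (Torus.proj (2 * reg.L k + 1) (Pi.single 0 (reg.L k : ℤ)), b, j)))‖ ^ (2 : ℕ)) ∂(wilsonMeasure (fundamentalRep (Fin 3)) (reg.β k))) / (∫ U : GaugeConfig 4 (2 * reg.L k + 1) (Matrix.specialUnitaryGroup (Fin 3) ℂ), ‖(diracMatrix U fun _ : Fin Nf => reg.mcrit k + reg.a k * m / reg.Zm k).det‖ ∂(wilsonMeasure (fundamentalRep (Fin 3)) (reg.β k)))) ≤ ‖(∫ U : GaugeConfig 4 (2 * reg.L k + 1) (Matrix.specialUnitaryGroup (Fin 3) ℂ), (diracMatrix U fun _ : Fin Nf => reg.mcrit k + reg.a k * m / reg.Zm k).det * ((∑ a : Fin 3, ∑ i : Fin 4, ∑ b : Fin 3, ∑ j : Fin 4, ‖(diracMatrix U fun _ : Fin Nf => reg.mcrit k + reg.a k * m / reg.Zm k)⁻¹ (quarkEquiv (f, (Torus.proj (2 * reg.L k + 1) 0, a, i))) (quarkEquiv (f, (Torus.proj (2 * reg.L k + 1) (Pi.single 0 (reg.L k : ℤ)), b, j)))‖ ^ (2 : ℕ) : ℝ) : ℂ) ∂(wilsonMeasure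 (fundamentalRep (Fin 3)) (reg.β k))) / (∫ U : GaugeConfig 4 (2 * reg.L k + 1) (Matrix.specialUnitaryGroup (Fin 3) ℂ), (diracMatrix U fun _ : Fin Nf => reg.mcrit k + reg.a k * m / reg.Zm k).det ∂(wilsonMeasure (fundamentalRep (Fin 3)) (reg.β k)))‖) → ∀ ε : ℝ, 0 < ε → ∃ m : ℝ, 0 < m ∧ ∀ C : ℝ, ∃ᶠ k in atTop, ∃ S : ℕ, reg.L k ≤ S ∧ ∃ n : ℕ, n ≤ S ∧ C * Real.exp (-(ε * (reg.a k * n))) < ‖(∫ U : GaugeConfig 4 (2 * S + 1) (Matrix.specialUnitaryGroup (Fin 3) ℂ), (diracMatrix U fun _ : Fin Nf => reg.mcrit k + reg.a k * m / reg.Zm k).det * ((∑ a : Fin 3, ∑ i : Fin 4, ∑ b : Fin 3, ∑ j : Fin 4, ‖(diracMatrix U fun _ : Fin Nf => reg.mcrit k + reg.a k * m / reg.Zm k)⁻¹ (quarkEquiv (f, (Torus.proj (2 * S + 1) 0, a, i))) (quarkEquiv (f, (Torus.proj (2 * S + 1) (Pi.single 0 (n : ℤ)), b, j)))‖ ^ (2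 : ℕ) : ℝ) : ℂ) ∂(wilsonMeasure (fundamentalRep (Fin 3)) (reg.β k))) / (∫ U : GaugeConfig 4 (2 * S + 1) (Matrix.specialUnitaryGroup (Fin 3) ℂ), (diracMatrix U fun _ : Fin Nf => reg.mcrit k + reg.a k * m / reg.Zm k).det ∂(wilsonMeasure (fundamentalRep (Fin 3)) (reg.β k)))‖ := by
  intro Nf hNf reg f ha1 hvol hNC hSC ε hε
  obtain ⟨θ, hθ, hcoh⟩ := hSC
  obtain ⟨m, s, c₀, C₁, p, hm, hs, hs2, hc₀, hC₁, hev⟩ := hNC ε hε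
  refine ⟨m, hm, fun C => ?_⟩
  set Cp : ℝ := max C 1 with hCp
  have hCp0 : 0 < Cp := lt_of_lt_of_le one_pos (le_max_right _ _)
  -- the lower pin moved to the scheme volume `S = n = L_k`, at rate `sε/2`, with a large constant
  have hviol := eventually_violation_at_schemeVolume_of_eventual_lowerPin reg.a reg.L (fun k S n => (∫ U : GaugeConfig 4 (2 * S + 1) (Matrix.specialUnitaryGroup (Fin 3) ℂ), ‖(diracMatrix U fun _ : Fin Nf => reg.mcrit k + reg.a k * m / reg.Zm k).det‖ * (∑ a : Fin 3, ∑ i : Fin 4, ∑ b : Fin 3, ∑ j : Fin 4, ‖(diracMatrix U fun _ : Fin Nf => reg.mcrit k + reg.a k * m / reg.Zm k)⁻¹ (quarkEquiv (f, (Torus.proj (2 * S + 1) 0, a, i))) (quarkEquiv (f, (Torus.proj (2 * S + 1) (Pi.single 0 (n : ℤ)), b, j)))‖) ^ s ∂(wilsonMeasure (fundamentalRep (Fin 3)) (reg.β k))) / (∫ U : GaugeConfig 4 (2 * S + 1) (Matrix.specialUnitaryGroup (Fin 3) ℂ), ‖(diracMatrix U fun _ : Fin Nf => reg.mcrit k +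 reg.a k * m / reg.Zm k).det‖ ∂(wilsonMeasure (fundamentalRep (Fin 3)) (reg.β k))))
    c₀ C₁ p (s * ε / 2) reg.a_pos ha1 hvol hc₀ hC₁ hev ((144 * Cp / θ) ^ (s / 2))
  refine Eventually.frequently (((hviol.and (hcoh m hm))).mono fun k hk => ?_)
  obtain ⟨hlt, hcohk⟩ := hk
  refine ⟨reg.L k, le_rfl, reg.L k, le_rfl, ?_⟩
  have hpt := fm_rpow_le_secondMoment_const Nf (2 * reg.L k + 1) hNf (reg.β k)
    (reg.mcrit k + reg.a k * m / reg.Zm k) s hs hs2 f (Torus.proj (2 * reg.L k + 1) 0)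
    (Torus.proj (2 * reg.L k + 1) (Pi.single 0 (reg.L k : ℤ)))
  -- abbreviate the three quotients at `S = n = L_k`
  set FM : ℝ := (∫ U : GaugeConfig 4 (2 * reg.L k + 1) (Matrix.specialUnitaryGroup (Fin 3) ℂ), ‖(diracMatrix U fun _ : Fin Nf => reg.mcrit k + reg.a k * m / reg.Zm k).det‖ * (∑ a : Fin 3, ∑ i : Fin 4, ∑ b : Fin 3, ∑ j : Fin 4, ‖(diracMatrix U fun _ : Fin Nf => reg.mcrit k + reg.a k * m / reg.Zm k)⁻¹ (quarkEquiv (f, (Torus.proj (2 * reg.L k + 1) 0, a, i))) (quarkEquiv (f, (Torus.proj (2 * reg.L k + 1) (Pi.single 0 (reg.L k : ℤ)), b, j)))‖) ^ s ∂(wilsonMeasure (fundamentalRep (Fin 3)) (reg.β k))) / (∫ U : GaugeConfig 4 (2 * reg.L k + 1) (Matrix.specialUnitaryGroup (Fin 3) ℂ), ‖(diracMatrix U fun _ : Fin Nf => reg.mcrit k + reg.a k * m / reg.Zm k).det‖ ∂(wilsonMeasure (fundamentalRep (Fin 3)) (reg.β k))) with hFMdef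
  set Q2 : ℝ := (∫ U : GaugeConfig 4 (2 * reg.L k + 1) (Matrix.specialUnitaryGroup (Fin 3) ℂ), ‖(diracMatrix U fun _ : Fin Nf => reg.mcrit k + reg.a k * m / reg.Zm k).det‖ * (∑ a : Fin 3, ∑ i : Fin 4, ∑ b : Fin 3, ∑ j : Fin 4, ‖(diracMatrix U fun _ : Fin Nf => reg.mcrit k + reg.a k * m / reg.Zm k)⁻¹ (quarkEquiv (f, (Torus.proj (2 * reg.L k + 1) 0, a, i))) (quarkEquiv (f, (Torus.proj (2 * reg.L k + 1) (Pi.single 0 (reg.L k : ℤ)), b, j)))‖ ^ (2 : ℕ)) ∂(wilsonMeasure (fundamentalRep (Fin 3)) (reg.β k))) / (∫ U : GaugeConfig 4 (2 * reg.L k + 1) (Matrix.specialUnitaryGroup (Fin 3) ℂ), ‖(diracMatrix U fun _ : Fin Nf => reg.mcrit k + reg.a k * m / reg.Zm k).det‖ ∂(wilsonMeasure (fundamentalRep (Fin 3)) (reg.β k))) with hQ2def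
  set QS : ℂ := (∫ U : GaugeConfig 4 (2 * reg.L k + 1) (Matrix.specialUnitaryGroup (Fin 3) ℂ), (diracMatrix U fun _ : Fin Nf => reg.mcrit k + reg.a k * m / reg.Zm k).det * ((∑ a : Fin 3, ∑ i : Fin 4, ∑ b : Fin 3, ∑ j : Fin 4, ‖(diracMatrix U fun _ : Fin Nf => reg.mcrit k + reg.a k * m / reg.Zm k)⁻¹ (quarkEquiv (f, (Torus.proj (2 * reg.L k + 1) 0, a, i))) (quarkEquiv (f, (Torus.proj (2 * reg.L k + 1) (Pi.single 0 (reg.L k : ℤ)), b, j)))‖ ^ (2 : ℕ) : ℝ) : ℂ) ∂(wilsonMeasure (fundamentalRep (Fin 3)) (reg.β k))) / (∫ U : GaugeConfig 4 (2 * reg.L k + 1) (Matrix.specialUnitaryGroup (Fin 3) ℂ), (diracMatrix U fun _ : Fin Nf => reg.mcrit k + reg.a k * m / reg.Zm k).det ∂(wilsonMeasure (fundamentalRep (Fin 3)) (reg.β k))) with hQSdef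
  change FM ^ (2 / s) ≤ 144 * Q2 at hpt
  change (144 * Cp / θ) ^ (s / 2) * Real.exp (-(s * ε / 2 * (reg.a k * reg.L k))) < FM at hlt
  change θ * Q2 ≤ ‖QS‖ at hcohk
  change C * Real.exp (-(ε * (reg.a k * (reg.L k : ℕ)))) < ‖QS‖
  have hbase : 0 ≤ 144 * Cp / θ * Real.exp (-(ε * (reg.a k * reg.L k))) := by positivity
  have hexp : Real.exp (-(s * ε / 2 * (reg.a k * reg.L k))) = Real.exp (-(ε * (reg.a k * reg.L k))) ^ (s / 2) := by
    rw [← Real.exp_mul]; congr 1; ring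
  have hlhs : (144 * Cp / θ) ^ (s / 2) * Real.exp (-(s * ε / 2 * (reg.a k * reg.L k))) =
      (144 * Cp / θ * Real.exp (-(ε * (reg.a k * reg.L k)))) ^ (s / 2) := by
    rw [hexp, Real.mul_rpow (by positivity) (Real.exp_pos _).le]
  rw [hlhs] at hlt
  have h2s : 0 < 2 / s := by positivity
  have h1 : ((144 * Cp / θ * Real.exp (-(ε * (reg.a k * reg.L k)))) ^ (s / 2)) ^ (2 / s) < FM ^ (2 / s) :=
    Real.rpow_lt_rpow (Real.rpow_nonneg hbase _) hlt h2s
  rw [← Real.rpow_mul hbase, show s / 2 * (2 / s) = 1 by field_simp, Real.rpow_one] at h1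
  -- `144 Cp/θ · e < FM^{2/s} ≤ 144 Q2`, so `Cp e < θ Q2 ≤ ‖QS‖`
  have h3 : 144 * Cp / θ * Real.exp (-(ε * (reg.a k * reg.L k))) < 144 * Q2 := h1.trans_le hpt
  have h4 : Cp * Real.exp (-(ε * (reg.a k * reg.L k))) < θ * Q2 := by
    have := mul_lt_mul_of_pos_left h3 hθ
    have hθ0 : θ ≠ 0 := hθ.ne'
    have hθ' : θ * (144 * Cp / θ * Real.exp (-(ε * (reg.a k * reg.L k)))) =
        144 * (Cp * Real.exp (-(ε * (reg.a k * reg.L k)))) := by field_simp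
    rw [hθ'] at this
    nlinarith [this]
  calc C * Real.exp (-(ε * (reg.a k * (reg.L k : ℕ)))) ≤ Cp * Real.exp (-(ε * (reg.a k * reg.L k))) :=
        mul_le_mul_of_nonneg_right (le_max_left _ _) (Real.exp_pos _).le
    _ < θ * Q2 := h4
    _ ≤ ‖QS‖ := hcohk

end Summit.QuantumFields.QCD.Cruxes.ChiralOneScaleTrajectory.GoldstoneWitness

end
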